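import Summits.SmoothPoincare4.SmoothPoincare4.Theses.EntropyRung
import Literature.Geometry.Lorentzian.EndChartIntegral
import Literature.Geometry.Lorentzian.EnergyCurrents
import Mathlib.Analysis.Calculus.Gradient.Basic
import HarnessLib

/-!
# The gradient square `|∇f|²_g` in a flat chart
(crux stmt-SmoothPoincare4-10871 `EntropyRung.SubcylindricalExistence`, line
`green-blowup-conformal-entropy`, stub S0 `stub_gradSqFlatChart` of lead c2's skeleton)

If the inverse `φ⁻¹` of the extended chart `φ = extChartAt (𝓡 n) p` is a `g`-isometry at a point
`y` of the chart target — `g(dφ⁻¹_y X, dφ⁻¹_y W) = ⟪X, W⟫` for all `X, W` — then for every `f`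
differentiable at `x = φ⁻¹ y`,

  `|∇f|²_g (x) = g⁻¹(df_x, df_x) = ‖∇(f ∘ φ⁻¹)(y)‖²`  (Euclidean gradient).

Pointwise linear algebra: `A = dφ⁻¹_y : ℝⁿ → T_x M` is a linear bijection
(`isInvertible_mfderivWithin_extChartAt_symm`), by flatness an isometry `(ℝⁿ, ⟪·,·⟫) → (T_x M, g_x)`;
by the chain rule `df_x (A X) = d(f ∘ φ⁻¹)_y X = ⟪∇(f ∘ φ⁻¹)(y), X⟫`, so `♯ df_x = A (∇(f ∘ φ⁻¹)(y))`
(`sharp_eq_of_forall`, every tangent vector being of the form `A X`), whence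
`g⁻¹(df, df) = df_x(♯ df_x) = ‖∇(f ∘ φ⁻¹)(y)‖²`. This is the case `c = 1` of
`Literature.Geometry.Riemannian.AubinYamabe.innerDual_mvfderiv_roundMetric_extChartAt_symm`
(round sphere, stereographic chart). Everything is proved; no definition, no named fact.

References: [ONeill1983] Ch. 3, p. 60 and Prop. 3.59 (local isometries preserve the metric
tensors); [LeeParker1987] §3, (3.4).
-/

noncomputable section

-- the registered namespace `Summit.SmoothPoincare4.SmoothPoincare4.Theorems` repeats a component
set_option linter.dupNamespace false

open scoped Manifold ContDiff Topology RealInnerProductSpace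
open Set InnerProductSpace
open Literature.Geometry.Lorentzian

namespace Summit.SmoothPoincare4.SmoothPoincare4.Theorems

section FlatChart

variable {n : ℕ} {M : Type*} [TopologicalSpace M] [ChartedSpace (EuclideanSpace ℝ (Fin n)) M]
  [IsManifold (𝓡 n) ∞ M] {m : ℕ∞ω}

omit [IsManifold (𝓡 n) ∞ M] in
/-- The inverse extended chart `(extChartAt (𝓡 n) p)⁻¹` is differentiable (models `𝓘(ℝ, ℝⁿ)`,
`𝓡 n`) at every point of the chart target. [folklore] -/
theorem mdifferentiableAt_extChartAt_symm_of_mem_target [IsManifold (𝓡 n) 1 M] (p : M)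
    {y : EuclideanSpace ℝ (Fin n)} (hy : y ∈ (extChartAt (𝓡 n) p).target) :
    MDifferentiableAt 𝓘(ℝ, EuclideanSpace ℝ (Fin n)) (𝓡 n) (extChartAt (𝓡 n) p).symm y := by
  have h := mdifferentiableWithinAt_extChartAt_symm hy
  rwa [ModelWithCorners.Boundaryless.range_eq_univ, mdifferentiableWithinAt_univ] at h

omit [IsManifold (𝓡 n) ∞ M] in
/-- The differential of the inverse extended chart `(extChartAt (𝓡 n) p)⁻¹` at a point of the
chart target is surjective (it is invertible, with inverse the differential of the chart).
[folklore] -/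
theorem surjective_mfderiv_extChartAt_symm [IsManifold (𝓡 n) 1 M] (p : M)
    {y : EuclideanSpace ℝ (Fin n)} (hy : y ∈ (extChartAt (𝓡 n) p).target) :
    Function.Surjective
      (mfderiv 𝓘(ℝ, EuclideanSpace ℝ (Fin n)) (𝓡 n) (extChartAt (𝓡 n) p).symm y) := by
  have h := isInvertible_mfderivWithin_extChartAt_symm hy
  rw [ModelWithCorners.Boundaryless.range_eq_univ, mfderivWithin_univ] at h
  exact h.surjective

omit [IsManifold (𝓡 n) ∞ M] in
/-- The differential of `f ∘ φ⁻¹` at `y` (model `𝓘(ℝ, ℝⁿ)`) pairs with `X` as the Euclidean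
gradient: `d(f ∘ φ⁻¹)_y X = ⟪∇(f ∘ φ⁻¹)(y), X⟫` (`mvfderiv` on the normed space `ℝⁿ` is `fderiv`,
the identification `NormedSpace.fromTangentSpace` being the identity; Riesz representation,
`gradient`). [folklore] -/
theorem mvfderiv_comp_extChartAt_symm_apply_eq_inner_gradient (p : M) (f : M → ℝ)
    (y : EuclideanSpace ℝ (Fin n)) (X : EuclideanSpace ℝ (Fin n)) :
    mvfderiv 𝓘(ℝ, EuclideanSpace ℝ (Fin n)) (f ∘ (extChartAt (𝓡 n) p).symm) y X =
      ⟪gradient (f ∘ (extChartAt (𝓡 n) p).symm) y, X⟫ := by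
  rw [gradient, toDual_symm_apply]
  simp only [mvfderiv, ContinuousLinearMap.comp_apply, mfderiv_eq_fderiv]
  rfl

/-- **`|∇f|²_g` in a flat chart** (workhorse, named hypotheses): if `φ⁻¹ = (extChartAt (𝓡 n) p)⁻¹`
is a `g`-isometry at `y ∈ φ.target`, i.e. `g(dφ⁻¹_y X, dφ⁻¹_y W) = ⟪X, W⟫`, then for `f`
differentiable at `φ⁻¹ y`, `g⁻¹(df, df)(φ⁻¹ y) = ‖∇(f ∘ φ⁻¹)(y)‖²`. O'Neill 1983, Ch. 3, p. 60 and
Prop. 3.59; Lee–Parker 1987, §3, (3.4) with conformal factor `1`.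
[cite: ONeill1983, Ch. 3, Prop. 3.59] -/
theorem gradSq_extChartAt_symm_of_flat
    (g : PseudoRiemannianMetric (𝓡 n) m (EuclideanSpace ℝ (Fin n)) (TangentSpace (𝓡 n) : M → Type _))
    (p : M) {y : EuclideanSpace ℝ (Fin n)} (hy : y ∈ (extChartAt (𝓡 n) p).target)
    (hflat : ∀ X W : EuclideanSpace ℝ (Fin n),
      g.val ((extChartAt (𝓡 n) p).symm y)
        (mfderiv 𝓘(ℝ, EuclideanSpace ℝ (Fin n)) (𝓡 n) (extChartAt (𝓡 n) p).symm y X)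
        (mfderiv 𝓘(ℝ, EuclideanSpace ℝ (Fin n)) (𝓡 n) (extChartAt (𝓡 n) p).symm y W) = ⟪X, W⟫)
    {f : M → ℝ} (hf : MDifferentiableAt (𝓡 n) 𝓘(ℝ, ℝ) f ((extChartAt (𝓡 n) p).symm y)) :
    g.gradSq f ((extChartAt (𝓡 n) p).symm y) =
      ‖gradient (f ∘ (extChartAt (𝓡 n) p).symm) y‖ ^ 2 := by
  set A := mfderiv 𝓘(ℝ, EuclideanSpace ℝ (Fin n)) (𝓡 n) (extChartAt (𝓡 n) p).symm y with hA
  set V : EuclideanSpace ℝ (Fin n) := gradient (f ∘ (extChartAt (𝓡 n) p).symm) y with hV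
  have hsymm : MDifferentiableAt 𝓘(ℝ, EuclideanSpace ℝ (Fin n)) (𝓡 n) (extChartAt (𝓡 n) p).symm y :=
    mdifferentiableAt_extChartAt_symm_of_mem_target p hy
  have hsurj : Function.Surjective A := surjective_mfderiv_extChartAt_symm p hy
  -- chain rule along `φ⁻¹`, read against the Euclidean gradient
  have hchain : ∀ X : EuclideanSpace ℝ (Fin n),
      mvfderiv (𝓡 n) f ((extChartAt (𝓡 n) p).symm y) (A X) = ⟪V, X⟫ := fun X ↦ by
    rw [hA, ← PseudoRiemannianMetric.mvfderiv_comp_apply hf hsymm X]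
    exact mvfderiv_comp_extChartAt_symm_apply_eq_inner_gradient p f y X
  -- `♯ df = A (∇(f ∘ φ⁻¹)(y))`
  have hsharp : g.sharp ((extChartAt (𝓡 n) p).symm y)
      (mvfderiv (𝓡 n) f ((extChartAt (𝓡 n) p).symm y) :
        TangentSpace (𝓡 n) ((extChartAt (𝓡 n) p).symm y) →ₗ[ℝ] ℝ) = A V := by
    refine PseudoRiemannianMetric.sharp_eq_of_forall g _ _ _ fun w ↦ ?_
    obtain ⟨X, rfl⟩ := hsurj w
    rw [ContinuousLinearMap.coe_coe, hchain, hA, hflat]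
  rw [PseudoRiemannianMetric.gradSq_eq, hsharp, hchain, real_inner_self_eq_norm_sq]

end FlatChart

/-- **Stub S0 of line `green-blowup-conformal-entropy` (registered form).** If the chart
`φ = extChartAt (𝓡 4) p` of a smooth closed 4-manifold inverts to a `g`-isometry at a point `y` of
its target (`g(dφ⁻¹_y X, dφ⁻¹_y W) = ⟪X, W⟫`), then for every `f` differentiable at `φ⁻¹ y`,
`|∇f|²_g(φ⁻¹ y) = ‖∇(f ∘ φ⁻¹)(y)‖²` (Euclidean gradient): `gradSq_extChartAt_symm_of_flat`.
[cite: ONeill1983, Ch. 3, Prop. 3.59] -/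
theorem stub_gradSqFlatChart :
    ∀ (M : Type) [TopologicalSpace M] [T2Space M] [SecondCountableTopology M]
      [ChartedSpace (EuclideanSpace ℝ (Fin 4)) M] [IsManifold (𝓡 4) ∞ M] [CompactSpace M]
      [T3Space M] [MeasurableSpace M] [BorelSpace M]
      (g : PseudoRiemannianMetric (𝓡 4) ∞ (EuclideanSpace ℝ (Fin 4)) (TangentSpace (𝓡 4) : M → Type _))
      (p : M) (y : EuclideanSpace ℝ (Fin 4)), y ∈ (extChartAt (𝓡 4) p).target →
      (∀ X W : EuclideanSpace ℝ (Fin 4),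
        g.val ((extChartAt (𝓡 4) p).symm y)
          (mfderiv 𝓘(ℝ, EuclideanSpace ℝ (Fin 4)) (𝓡 4) (extChartAt (𝓡 4) p).symm y X)
          (mfderiv 𝓘(ℝ, EuclideanSpace ℝ (Fin 4)) (𝓡 4) (extChartAt (𝓡 4) p).symm y W) = ⟪X, W⟫) →
      ∀ f : M → ℝ, MDifferentiableAt (𝓡 4) 𝓘(ℝ, ℝ) f ((extChartAt (𝓡 4) p).symm y) →
        g.gradSq f ((extChartAt (𝓡 4) p).symm y) = ‖gradient (f ∘ (extChartAt (𝓡 4) p).symm) y‖ ^ 2 := by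
  intro M _ _ _ _ _ _ _ _ _ g p y hy hflat f hf
  exact gradSq_extChartAt_symm_of_flat g p hy hflat hf

end Summit.SmoothPoincare4.SmoothPoincare4.Theorems

end
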